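import Summits.BirchSwinnertonDyer.BirchSwinnertonDyer.Theorems.SchneiderFreeAdditiveX3AnticycControlAdditiveNoLocalPTorsionAtoms
import HarnessLib

/-!
# Crux `AnticycControlAdditive` (route `SchneiderFreeAdditiveX3`, items stmt-BirchSwinnertonDyer-19178 /
# 19295): the `t_p = 0` half CLOSED MODULO CITED FACTS (part 2: T-B6-2′ and the registered stub)

Seat `bsd-schneider-door-c4`, gen 2 (cell `bsd-schneider-ideate`). Part 1
(`…AnticycControlAdditiveNoLocalPTorsionAtoms.lean`) discharged, at an additive datum with Castella's (iv)
`E(ℚ_p)[p] = 0`, the three Poitou–Tate atoms of gen 0's BC5 rung `additiveControlOnTreeAt_of_atoms`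
((P6-add) base count, (P9) `LocSurjAt`, (L10) `CoinvariantsTrivialAt`) modulo cited facts; the local atom
(P11) is Brink's decomposition law ∘ `localKernelOrderAt_of_not_le` (route R1). Here:

* `additiveControlOnTreeAt_of_facts_of_noPTorsionPadic` — T-B6-2′ (`SchneiderFree.AdditiveControlOnTreeAt`,
  the anticyclotomic control EQUALITY at an additive prime) at every frame with `E(ℚ_p)[p] = 0`, from the
  rank-one inputs (`rank E(K) = 1`, `Ш(E/K)` finite) and the five cited cohomological / class-field-theoretic
  facts;
* **`stub_control_noLocalPTorsion_of_facts`** — the REGISTERED stub `stub_control_noLocalPTorsion` of the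
  BC3 skeleton `4a862010…` (its signature verbatim as the conclusion), from Kolyvagin's theorem (the
  antecedent of the rev-6 item `AnticycControlAdditiveK`) and the five cited facts — NOTHING typed on
  constructed objects remains on the `t_p = 0` half of the crux;
* `anticycControlAdditive_noPTorsionPadic_of_facts` — the same keyed to Castella's form of (iv).

Cited facts (tree `def`s with sources, hypotheses BY NAME): `kolyvagin` (Kolyvagin 1990 Thm. A / Gross
1991 Thm. 1.3), `poitouTate_selmerStructure_duality` (Milne ADT I 4.10(b)), `poitouTate_sha_tateDual`
(Milne ADT I 4.10(a)), `localEulerPoincareCharacteristic` (Milne ADT I 2.8), `fieldCdLE_two_of_numberField`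
(Serre II §4.4 Prop. 13), `ZpExtension.decomp_not_le_kerSubgroup_of_isAnticyclotomic` (Brink 2007 Thm. 2 /
Cor. 1). CONDITIONAL; no `Prop` fact minted; closes nothing by itself; BSD is not proved by any of this.
The `t_p ≥ 1` half of the crux (Fin_v + the torsion-robust atoms of `additiveControlOnTreeAt_of_torsAtoms`)
is untouched.

References: [JetchevSkinnerWan2017] §3.2–3.3 (arXiv:1512.06894 pp. 10–14); [Castella2018] Thm. 2.3;
[Castella2018Erratum] Thm. 1.1 (iv); [MilneADT2006] I 2.8, 4.10; [Brink2007] Thm. 2, Cor. 1;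
[Kolyvagin1990] Thm. A.
-/

noncomputable section

open scoped Classical

open WeierstrassCurve NumberField IsDedekindDomain Field Literature.NumberTheory.EllipticCurves
  Literature.NumberTheory.EllipticCurves.ModularForms
  Literature.NumberTheory.EllipticCurves.GreenbergSelmer
  Literature.NumberTheory.GaloisRepresentations
  Literature.NumberTheory.GaloisCohomology
  Literature.NumberTheory.EllipticCurves.Rank1Residual
  Literature.NumberTheory.EllipticCurves.Rank1Residual.Typed
  Summit.BirchSwinnertonDyer.Rank1Residual
  Summit.BirchSwinnertonDyer.Rank1Residual.X11b
  Summit.BirchSwinnertonDyer.Rank1Residual.X11b.AcSelmer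
  Summit.BirchSwinnertonDyer.Rank1Residual.X11b.LocBridge
  Summit.BirchSwinnertonDyer.BirchSwinnertonDyer.Theorems.SchneiderFree
  Summit.BirchSwinnertonDyer.BirchSwinnertonDyer.Theorems.SchneiderFreeControlAtoms

set_option linter.dupNamespace false

namespace Summit.BirchSwinnertonDyer.BirchSwinnertonDyer.Theorems.SchneiderFreeAdditiveX3

/-! ## §4. T-B6-2′ at an additive frame with `E(ℚ_p)[p] = 0`, from the cited facts -/

section Pointwise

variable {W : WeierstrassCurve ℚ} [W.IsElliptic] [W.IsGloballyMinimal] {K : Type} [Field K]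
  [NumberField K] {p : ℕ} [Fact p.Prime] {κ : ZpExtension K p}

/-- **T-B6-2′ (`SchneiderFree.AdditiveControlOnTreeAt`) at a frame with `E(ℚ_p)[p] = 0`, from the cited
facts and the rank-one inputs** — for `K` imaginary quadratic with the additive `p` split, `κ`
anticyclotomic with topological generator `γ`, a degree-one `𝔭 ∋ p`, `rank E(K) = 1`, `Ш(E/K)` finite
and `P ∈ E(K)` non-torsion: the anticyclotomic control EQUALITY
`ord_p f_ac(0) = ord_p #Ш(E/K)[p^∞] + 2(ord_p log_ω P − ord_p[E(K):ℤP]) + ord_p ∏_{w∣N⁺} c_w(E/K)`.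
Every atom of gen 0's BC5 rung `additiveControlOnTreeAt_of_atoms` is discharged: (P6-add) §2, (P9) and
(L10) §3, (P11) Brink via `r1LocalKernelOrderAt_of_anticyclotomicDecomposition`, and the frame's
`E(K_𝔭)[p] = 0` by §1. CONDITIONAL on the five cited facts (hypotheses by name).
[cite: JetchevSkinnerWan2017, Thm. 3.3.1 (arXiv:1512.06894 p. 11)] [cite: Castella2018, Thm. 2.3 (arXiv:1704.06608 p. 5)]
[cite: MilneADT2006, Ch. I, Thm. 4.10 and Thm. 2.8] [cite: Brink2007, Thm. 2 and Cor. 1] -/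
theorem additiveControlOnTreeAt_of_facts_of_noPTorsionPadic
    (hPT : poitouTate_selmerStructure_duality K) (hPT2 : poitouTate_sha_tateDual K)
    (hEP : ∀ v : HeightOneSpectrum (𝓞 K), localEulerPoincareCharacteristic (v.adicCompletion K))
    (hcd : fieldCdLE_two_of_numberField)
    (hBr : ZpExtension.decomp_not_le_kerSubgroup_of_isAnticyclotomic K p)
    (hiv : ∀ R : (W.baseChange ℚ_[p]).toAffine.Point, p • R = 0 → R = 0) (hp2 : p ≠ 2)
    (hadd : Addv W p) (hK : IsImaginaryQuadratic K) (hsplit : SplitsIn K p) (hκ : κ.IsAnticyclotomic)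
    (γ : absoluteGaloisGroup K) [hγ : Fact (κ.IsTopGenerator γ)] (𝔭 : HeightOneSpectrum (𝓞 K))
    (h𝔭 : ((p : ℕ) : 𝓞 K) ∈ 𝔭.asIdeal) (he : 𝔭.asIdeal.ramificationIdx (𝓞 ℚ) = 1)
    (hf : 𝔭.asIdeal.inertiaDeg (𝓞 ℚ) = 1)
    (hrank : (W.baseChange K).mordellWeilRank = 1) (hSha : (W.baseChange K).ShaFinite)
    (P : (W.baseChange K).toAffine.Point) (hPinf : ¬ IsOfFinAddOrder P) :
    AdditiveControlOnTreeAt p κ 𝔭 γ (embAt K p 𝔭 h𝔭 he hf) P := by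
  have hpN : p ∣ W.conductorNorm ℤ := (W.dvd_conductorNorm_iff_not_hasGoodReductionAtPrime p).mpr hadd.1
  have hfin : ∀ v : HeightOneSpectrum (𝓞 K), ((p : ℕ) : 𝓞 K) ∈ v.asIdeal →
      Finite (selmerAcBase (W.baseChange K) p v ∅) := fun v hv ↦ by
    obtain ⟨he', hf'⟩ := degreeOne_of_splitsIn hK.1 hsplit hv
    obtain ⟨a, ⟨hfinv, -⟩, -⟩ := additiveBaseSelmerCountAt_of_facts W p hiv hadd hK hsplit hPT hEP hrank
      hSha P hPinf v hv he' hf'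
    exact hfinv
  obtain ⟨σ, 𝔮, -, hne, h𝔮, -⟩ :=
    LocalIndexTransport.exists_conj_prime_of_splitsIn K p hK.1 hsplit h𝔭
  exact additiveControlOnTreeAt_of_atoms (W := W) hK hsplit hpN hκ γ 𝔭 (embAt K p 𝔭 h𝔭 he hf) P
    (noFixedPTorsion_decomp_of_noPTorsionPadic W p hiv 𝔭 h𝔭 he hf)
    (additiveBaseSelmerCountAt_of_facts W p hiv hadd hK hsplit hPT hEP hrank hSha P hPinf 𝔭 h𝔭 he hf)
    (locSurjAt_of_facts W p hiv hK hPT hEP κ h𝔭 he hf h𝔮 hne (hfin 𝔮 h𝔮))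
    (coinvariantsTrivialAt_of_facts W p hiv hK hsplit hPT hPT2 hEP hcd κ hγ.out h𝔭 he hf hfin)
    (fun v hv ↦ by
      obtain ⟨hpv, -, he1, hf1⟩ := (mem_nPlusPlaces_iff v).mp hv
      exact localKernelOrderAt_of_not_le (W.baseChange K) κ hpv (hBr hK hp2 κ hκ v hpv he1 hf1))

end Pointwise

/-! ## §5. Class level: the registered stub `stub_control_noLocalPTorsion` from the cited facts -/

section ClassLevel

open Summit.BirchSwinnertonDyer.BirchSwinnertonDyer.Theses.SchneiderFreeAdditiveX3

/-- **The registered stub `stub_control_noLocalPTorsion` of crux `AnticycControlAdditive` (BC3 skeleton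
`4a862010…`; the `t_p = 0` half: B6 Heegner data and anticyclotomic frames with `E(K_𝔭)[p] = 0`) —
its signature VERBATIM, CLOSED MODULO the cited facts.** From Kolyvagin's theorem (`rank E(K) = 1`,
`Ш(E/K)` finite at the non-torsion Heegner point), Poitou–Tate duality for Selmer structures and for `Ш`,
the local Euler–Poincaré characteristic, `cd_p(Γ_K) ≤ 2`, and Brink's anticyclotomic decomposition law —
all carried as NAMED hypotheses — and nothing typed on constructed objects: gen 0's four atoms are the
theorems of §2–§3 and Brink ∘ `localKernelOrderAt_of_not_le`; the frame hypothesis is turned into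
Castella's (iv) by `noPTorsionPadic_of_noFixedPTorsion_decomp`. CONDITIONAL (a `conditional-result` on six
published facts); closes nothing by itself; BSD is not proved by any of this.
[cite: JetchevSkinnerWan2017, Thm. 3.3.1, Prop. 3.2.1, Prop. 3.3.2, Lemma 3.3.3, Prop. 3.3.4 (arXiv:1512.06894 pp. 10–13)]
[cite: Castella2018, Thm. 2.3 (arXiv:1704.06608 p. 5)] [cite: Kolyvagin1990, Thm. A]
[cite: MilneADT2006, Ch. I, Thm. 4.10 and Thm. 2.8] [cite: Brink2007, Thm. 2 and Cor. 1] -/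
theorem stub_control_noLocalPTorsion_of_facts
    (hKo : ∀ (N : ℕ) [NeZero N] (W : WeierstrassCurve ℚ) (K : Type) [Field K] [NumberField K],
      kolyvagin N W K)
    (hPT : ∀ (K : Type) [Field K] [NumberField K], poitouTate_selmerStructure_duality K)
    (hPT2 : ∀ (K : Type) [Field K] [NumberField K], poitouTate_sha_tateDual K)
    (hEP : ∀ (K : Type) [Field K] [NumberField K] (v : HeightOneSpectrum (𝓞 K)),
      localEulerPoincareCharacteristic (v.adicCompletion K))
    (hcd : fieldCdLE_two_of_numberField)
    (hBr : ∀ (K : Type) [Field K] [NumberField K] (p : ℕ) [Fact p.Prime],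
      ZpExtension.decomp_not_le_kerSubgroup_of_isAnticyclotomic K p) :
    ∀ (W : WeierstrassCurve ℚ) [W.IsElliptic] [W.IsGloballyMinimal] (p : ℕ) [Fact p.Prime],
      W.analyticRank = 1 → p ≠ 2 → ClassX3 W p → Additive.SubSemistableTwist W p →
      ∀ (N : ℕ) [NeZero N] (K : Type) [Field K] [NumberField K]
        (Dt : ModularParametrizationData W N) (H : HeegnerDatum N (NumberField.discr K)) (ι : K →+* ℂ)
        (P : (W.baseChange K).toAffine.Point),
        W.analyticRank = 1 → Additive.N10.Locus W p → W.conductorNorm ℤ = N → IsImaginaryQuadratic K →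
        Odd (NumberField.discr K) → ¬ p ∣ Units.torsionOrder K → SatisfiesHeegnerHypothesis N K →
        (W.quadraticTwist (NumberField.discr K : ℚ)).entireLFunction 1 ≠ 0 →
        WeierstrassCurve.Affine.Point.map ι.toRatAlgHom P = heegnerPointComplex Dt H →
        ¬ IsOfFinAddOrder P →
        ∀ (κ : ZpExtension K p), κ.IsAnticyclotomic →
          ∀ (γ : Field.absoluteGaloisGroup K) [Fact (κ.IsTopGenerator γ)]
            (𝔭 : HeightOneSpectrum (𝓞 K)) (h𝔭 : ((p : ℕ) : 𝓞 K) ∈ 𝔭.asIdeal)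
            (he : 𝔭.asIdeal.ramificationIdx (𝓞 ℚ) = 1) (hf : 𝔭.asIdeal.inertiaDeg (𝓞 ℚ) = 1),
            (∀ m : (W.baseChange K).geomPrimaryTorsion p,
              (∀ d ∈ decomp 𝔭, d • m = m) → p • m = 0 → m = 0) →
            AdditiveControlOnTreeAt p κ 𝔭 γ (embAt K p 𝔭 h𝔭 he hf) P := by
  intro W _ _ p _ hr hp2 hX hS N _ K _ _ Dt H ι P hr' hloc hN hK hodd hunit hHe hL1 hP hnt κ hκ γ _ 𝔭
    h𝔭 he hf h0
  have hpN : p ∣ W.conductorNorm ℤ := dvd_conductorNorm_of_n10Locus hloc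
  have hsplit : SplitsIn K p := splitsIn_of_satisfiesHeegnerHypothesis hN hHe hpN
  have hiv := noPTorsionPadic_of_noFixedPTorsion_decomp W p 𝔭 h𝔭 he hf h0
  obtain ⟨hrank, hSha⟩ := hKo N W K hK hHe ⟨Dt, H, ι, hP⟩ hnt
  exact additiveControlOnTreeAt_of_facts_of_noPTorsionPadic (hPT K) (hPT2 K) (hEP K) hcd (hBr K p) hiv
    hp2 hloc.2.1 hK hsplit hκ γ 𝔭 h𝔭 he hf hrank hSha P hnt

/-- **The same, keyed to the rev-6 item `AnticycControlAdditiveK`** (Kolyvagin's theorem FIRST, then the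
five cited cohomological / class-field-theoretic facts): on the `t_p = 0` frames — those with
`E(ℚ_p)[p] = 0`, Castella's (iv), i.e. every cell at `p ≥ 5` except III@5 / II@7 and the `(3, e = 2)` pairs
without local `3`-torsion — the pointwise socket `AdditiveControlOnTreeAt` holds at every B6 Heegner datum
and every anticyclotomic frame. The remaining (`t_p = 1`) frames are the crux's open half (Fin_v and the
torsion-robust atoms of `additiveControlOnTreeAt_of_torsAtoms`). CONDITIONAL; closes nothing by itself.
[cite: JetchevSkinnerWan2017, Thm. 3.3.1 (arXiv:1512.06894 p. 11)] [cite: Kolyvagin1990, Thm. A]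
[cite: MilneADT2006, Ch. I, Thm. 4.10 and Thm. 2.8] [cite: Brink2007, Thm. 2 and Cor. 1] -/
theorem anticycControlAdditive_noPTorsionPadic_of_facts
    (hKo : ∀ (N : ℕ) [NeZero N] (W : WeierstrassCurve ℚ) (K : Type) [Field K] [NumberField K],
      kolyvagin N W K)
    (hPT : ∀ (K : Type) [Field K] [NumberField K], poitouTate_selmerStructure_duality K)
    (hPT2 : ∀ (K : Type) [Field K] [NumberField K], poitouTate_sha_tateDual K)
    (hEP : ∀ (K : Type) [Field K] [NumberField K] (v : HeightOneSpectrum (𝓞 K)),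
      localEulerPoincareCharacteristic (v.adicCompletion K))
    (hcd : fieldCdLE_two_of_numberField)
    (hBr : ∀ (K : Type) [Field K] [NumberField K] (p : ℕ) [Fact p.Prime],
      ZpExtension.decomp_not_le_kerSubgroup_of_isAnticyclotomic K p) :
    ∀ (W : WeierstrassCurve ℚ) [W.IsElliptic] [W.IsGloballyMinimal] (p : ℕ) [Fact p.Prime],
      W.analyticRank = 1 → p ≠ 2 → ClassX3 W p → Additive.SubSemistableTwist W p →
      (∀ R : (W.baseChange ℚ_[p]).toAffine.Point, p • R = 0 → R = 0) →
      ∀ (N : ℕ) [NeZero N] (K : Type) [Field K] [NumberField K]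
        (Dt : ModularParametrizationData W N) (H : HeegnerDatum N (NumberField.discr K)) (ι : K →+* ℂ)
        (P : (W.baseChange K).toAffine.Point),
        W.analyticRank = 1 → Additive.N10.Locus W p → W.conductorNorm ℤ = N → IsImaginaryQuadratic K →
        Odd (NumberField.discr K) → ¬ p ∣ Units.torsionOrder K → SatisfiesHeegnerHypothesis N K →
        (W.quadraticTwist (NumberField.discr K : ℚ)).entireLFunction 1 ≠ 0 →
        WeierstrassCurve.Affine.Point.map ι.toRatAlgHom P = heegnerPointComplex Dt H →
        ¬ IsOfFinAddOrder P →
        ∀ (κ : ZpExtension K p), κ.IsAnticyclotomic →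
          ∀ (γ : Field.absoluteGaloisGroup K) [Fact (κ.IsTopGenerator γ)]
            (𝔭 : HeightOneSpectrum (𝓞 K)) (h𝔭 : ((p : ℕ) : 𝓞 K) ∈ 𝔭.asIdeal)
            (he : 𝔭.asIdeal.ramificationIdx (𝓞 ℚ) = 1) (hf : 𝔭.asIdeal.inertiaDeg (𝓞 ℚ) = 1),
            AdditiveControlOnTreeAt p κ 𝔭 γ (embAt K p 𝔭 h𝔭 he hf) P := by
  intro W _ _ p _ hr hp2 hX hS hiv N _ K _ _ Dt H ι P hr' hloc hN hK hodd hunit hHe hL1 hP hnt κ hκ γ _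
    𝔭 h𝔭 he hf
  have hpN : p ∣ W.conductorNorm ℤ := dvd_conductorNorm_of_n10Locus hloc
  have hsplit : SplitsIn K p := splitsIn_of_satisfiesHeegnerHypothesis hN hHe hpN
  obtain ⟨hrank, hSha⟩ := hKo N W K hK hHe ⟨Dt, H, ι, hP⟩ hnt
  exact additiveControlOnTreeAt_of_facts_of_noPTorsionPadic (hPT K) (hPT2 K) (hEP K) hcd (hBr K p) hiv
    hp2 hloc.2.1 hK hsplit hκ γ 𝔭 h𝔭 he hf hrank hSha P hnt

end ClassLevel

end Summit.BirchSwinnertonDyer.BirchSwinnertonDyer.Theorems.SchneiderFreeAdditiveX3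

end
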